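import Summits.AnomalousDissipation.AnomalousDissipation.Theorems.EnsembleRigidityDefs
import Summits.AnomalousDissipation.AnomalousDissipation.Theorems.TaylorCertificatesSteadyStatesLoudBoundedStubGpAdmissible
import Literature.Analysis.FluidPDE.CylindricalGenerator
import Literature.Analysis.FluidPDE.StokesTorusProofs
import Literature.Analysis.FunctionSpaces.TorusTrigPoly
import Literature.Analysis.FunctionSpaces.TorusFourierCalculus
import HarnessLib

/-!
# Stub `stub_gpSmallEnergy` of line `Sketch` (crux stmt-AnomalousDissipation-15508,
# `EnsembleRigidity.GPStatisticalRigidity`): the second-moment test with `w = f_GP`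

For the Galloway–Proctor force `f_GP(x) = sin(2πx₂)e₀ + sin(2πx₀)e₁ + sin(2πx₁)e₂` on `T³`
(`gpForce`, the inline sum of the three sine Stokes modes `Torus.stokesMode eⱼ eᵢ false`,
`(j, i) = (2, 0), (0, 1), (1, 2)`) and a probability measure `μ` on the energy space `H` with mean
energy `∫ |v|² dμ ≤ E`, the tested generator of forced Euler against the force itself obeys
`∫ ⟨f_GP − B(v,v), f_GP⟩ dμ ≥ 3/2 − 2πE`, so a balance `|∫ ⟨f_GP − B(v,v), f_GP⟩ dμ| ≤ R ‖∇f_GP‖₂`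
forces `R ≥ (3/2 − 2πE)/(π√6)` (`stub_gpSmallEnergy`, registered on the crux). Ingredients, all
elementary:

* `gpForce_fderiv_apply` — `Df_GP(x) u = 2π (u₂ cos 2πx₂, u₀ cos 2πx₀, u₁ cos 2πx₁)` (the partial
  derivative of a sine Stokes mode is `2π kᵢ` times the cosine mode, `gpForce_partialDeriv_stokesMode_sin`,
  from `Torus.partialDeriv_realTrigPoly`; additivity `Torus.fderiv_add`);
* `gpForce_inner_fderiv_apply_ge` — the pointwise bound `⟪Df_GP(x) u, u⟫ ≥ −2π |u|²`
  (`|cos| ≤ 1`, `|uᵢuⱼ| ≤ (uᵢ² + uⱼ²)/2`), whence `∫ (u ⊗ u) : ∇f_GP ≥ −2π ‖u‖²_{L²}` on `L²`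
  (`gpForce_inertialPairing_ge`);
* `gpForce_integral_inner_self` — `∫ |f_GP|² = 3/2` and `gpForce_gradNormSq` — `‖∇f_GP‖₂² = 6π²`
  (the three modes have pointwise orthogonal amplitudes `e₀, e₁, e₂`, and `∫ |stokesMode k a c|² = ‖a‖²/2`,
  `Torus.inner_stokesModeL2_self`);
* the `μ`-integration: `v ↦ ∫ (v ⊗ v) : ∇f_GP` is continuous on `H` (`Torus.continuous_inertialPairing_coe`)
  and quadratically bounded (`Torus.integrable_inner_fderiv_apply_coe`), hence `μ`-integrable when
  `∫ |v|² dμ < ∞`.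
-/

-- `Summit.<Summit>.<Problem>` is the tree's mandated summit-side namespace (CONVENTIONS §2); single-conjunct summit, duplicate deliberate.
set_option linter.dupNamespace false

noncomputable section

namespace Summit.AnomalousDissipation.AnomalousDissipation.Theorems.EnsembleRigidity.GPStatisticalRigidity

open MeasureTheory Filter Topology UnitAddTorus
open scoped InnerProductSpace RealInnerProductSpace ENNReal NNReal
open Literature.Analysis.FunctionSpaces Literature.Analysis.FluidPDE
open Summit.AnomalousDissipation.AnomalousDissipation.Theorems.EnsembleRigidity

/-- Local notation: real vector fields on `T³`. -/
local notation "Vec3" => (UnitAddTorus (Fin 3)) → (EuclideanSpace ℝ (Fin 3))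
/-- Local notation: `L²(T³; ℝ³)`. -/
local notation "L2" => (Lp (EuclideanSpace ℝ (Fin 3)) 2 (volume : Measure (UnitAddTorus (Fin 3))))
/-- Local notation: the energy space `H`. -/
local notation "H3" => (Torus.energySpace (Fin 3))

/-! ## Single Stokes modes: `L²` norm and derivative -/

/-- `∫ ‖stokesMode k a c‖² = ‖a‖²/2` for `k ≠ 0`. [folklore] -/
theorem gpForce_integral_norm_sq_stokesMode {k : Fin 3 → ℤ} (hk : k ≠ 0)
    (a : EuclideanSpace ℝ (Fin 3)) (c : Bool) :
    ∫ x, ‖Torus.stokesMode k a c x‖ ^ 2 = ‖a‖ ^ 2 / 2 := by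
  rw [← Torus.inner_stokesModeL2_self hk a c, real_inner_self_eq_norm_sq,
    ← Torus.integral_norm_sq_coe_eq]
  refine integral_congr_ae ?_
  filter_upwards [Torus.coeFn_stokesModeL2 k a c] with x hx
  rw [hx]

/-- `∂ᵢ (sin(2π k·x) a) = 2π kᵢ cos(2π k·x) a`. [folklore] -/
theorem gpForce_partialDeriv_stokesMode_sin (k : Fin 3 → ℤ) (a : EuclideanSpace ℝ (Fin 3))
    (i : Fin 3) (x : UnitAddTorus (Fin 3)) :
    Torus.partialDeriv i (⇑(Torus.stokesMode k a false)) x =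
      (2 * Real.pi * (k i : ℝ)) • Torus.stokesMode k a true x := by
  rw [Torus.stokesMode_eq_realTrigPoly, Torus.partialDeriv_realTrigPoly,
    Torus.realTrigPoly_singleton_apply, Torus.stokesMode_apply]
  ext j
  simp [EuclideanSpace.realPart_apply, EuclideanSpace.complexify_apply, Complex.mul_re,
    Complex.mul_im]
  ring

/-- `D(sin(2π x_j) a)(x) u = 2π u_j cos(2π x_j) a`. [folklore] -/
theorem gpForce_fderiv_stokesMode_sin (j : Fin 3) (a : EuclideanSpace ℝ (Fin 3))
    (x : UnitAddTorus (Fin 3)) (u : EuclideanSpace ℝ (Fin 3)) :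
    Torus.fderiv (⇑(Torus.stokesMode (Pi.single j (1 : ℤ)) a false)) x u =
      (2 * Real.pi * u j) • Torus.stokesMode (Pi.single j (1 : ℤ)) a true x := by
  have h1 : Torus.IsContDiff 1 (⇑(Torus.stokesMode (Pi.single j (1 : ℤ)) a false)) :=
    (Torus.isSmooth_stokesMode _ _ _).isContDiff (by simp)
  rw [Torus.fderiv_apply_eq_sum_partialDeriv h1]
  simp_rw [gpForce_partialDeriv_stokesMode_sin, smul_smul]
  rw [Finset.sum_eq_single j]
  · simp [mul_comm]
  · intro i _ hij
    simp [hij]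
  · intro h; exact absurd (Finset.mem_univ j) h

/-! ## The Galloway–Proctor force: derivative, energy, enstrophy -/

/-- `f_GP` is smooth (landed `stub_gpAdmissible`). [folklore] -/
theorem gpForce_isSmooth : Torus.IsSmooth gpForce :=
  SteadyStatesLoudBounded.GpAdmissible.stub_gpAdmissible.1

/-- **The derivative of `f_GP`**: `Df_GP(x) u = 2π (u₂ cos 2πx₂, u₀ cos 2πx₀, u₁ cos 2πx₁)`, as a
combination of the three cosine Stokes modes. [folklore] -/
theorem gpForce_fderiv_apply (x : UnitAddTorus (Fin 3)) (u : EuclideanSpace ℝ (Fin 3)) :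
    Torus.fderiv gpForce x u =
      (2 * Real.pi * u 2) •
          Torus.stokesMode (Pi.single (2 : Fin 3) (1 : ℤ)) (EuclideanSpace.single (0 : Fin 3) (1 : ℝ)) true x +
        (2 * Real.pi * u 0) •
          Torus.stokesMode (Pi.single (0 : Fin 3) (1 : ℤ)) (EuclideanSpace.single (1 : Fin 3) (1 : ℝ)) true x +
        (2 * Real.pi * u 1) •
          Torus.stokesMode (Pi.single (1 : Fin 3) (1 : ℤ)) (EuclideanSpace.single (2 : Fin 3) (1 : ℝ)) true x := by
  have h0 : Torus.IsContDiff 1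
      (⇑(Torus.stokesMode (Pi.single (2 : Fin 3) (1 : ℤ)) (EuclideanSpace.single (0 : Fin 3) (1 : ℝ)) false)) :=
    (Torus.isSmooth_stokesMode _ _ _).isContDiff (by simp)
  have h1 : Torus.IsContDiff 1
      (⇑(Torus.stokesMode (Pi.single (0 : Fin 3) (1 : ℤ)) (EuclideanSpace.single (1 : Fin 3) (1 : ℝ)) false)) :=
    (Torus.isSmooth_stokesMode _ _ _).isContDiff (by simp)
  have h2 : Torus.IsContDiff 1
      (⇑(Torus.stokesMode (Pi.single (1 : Fin 3) (1 : ℤ)) (EuclideanSpace.single (2 : Fin 3) (1 : ℝ)) false)) :=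
    (Torus.isSmooth_stokesMode _ _ _).isContDiff (by simp)
  have hgp : gpForce =
      ⇑(Torus.stokesMode (Pi.single (2 : Fin 3) (1 : ℤ)) (EuclideanSpace.single (0 : Fin 3) (1 : ℝ)) false) +
        ⇑(Torus.stokesMode (Pi.single (0 : Fin 3) (1 : ℤ)) (EuclideanSpace.single (1 : Fin 3) (1 : ℝ)) false) +
        ⇑(Torus.stokesMode (Pi.single (1 : Fin 3) (1 : ℤ)) (EuclideanSpace.single (2 : Fin 3) (1 : ℝ)) false) :=
    rfl
  rw [hgp, Torus.fderiv_add (h0.add h1) h2, Torus.fderiv_add h0 h1, add_apply, add_apply,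
    gpForce_fderiv_stokesMode_sin, gpForce_fderiv_stokesMode_sin,
    gpForce_fderiv_stokesMode_sin]

/-- **Pointwise lower bound for the symmetric part of `Df_GP`**: `⟪Df_GP(x) u, u⟫ ≥ -2π |u|²`
(`⟪Df_GP(x) u, u⟫ = 2π (c₂ u₂ u₀ + c₀ u₀ u₁ + c₁ u₁ u₂)` with `|cⱼ| = |cos 2πxⱼ| ≤ 1` and
`|uᵢ uⱼ| ≤ (uᵢ² + uⱼ²)/2`). [folklore] -/
theorem gpForce_inner_fderiv_apply_ge (x : UnitAddTorus (Fin 3)) (u : EuclideanSpace ℝ (Fin 3)) :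
    -(2 * Real.pi) * ‖u‖ ^ 2 ≤ ⟪Torus.fderiv gpForce x u, u⟫_ℝ := by
  rw [gpForce_fderiv_apply]
  simp only [Torus.stokesMode_apply, inner_add_left, real_inner_smul_left,
    EuclideanSpace.inner_single_left]
  simp only [if_true, map_one, one_mul]
  set c0 : ℝ := (mFourier (Pi.single (0 : Fin 3) (1 : ℤ)) x).re with hc0
  set c1 : ℝ := (mFourier (Pi.single (1 : Fin 3) (1 : ℤ)) x).re with hc1
  set c2 : ℝ := (mFourier (Pi.single (2 : Fin 3) (1 : ℤ)) x).re with hc2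
  have hb : ∀ k : Fin 3 → ℤ, |(mFourier k x).re| ≤ 1 := fun k =>
    (Complex.abs_re_le_norm _).trans (by simp [mFourier])
  have hu : ‖u‖ ^ 2 = u 0 ^ 2 + u 1 ^ 2 + u 2 ^ 2 := by
    rw [EuclideanSpace.norm_sq_eq, Fin.sum_univ_three]
    simp [sq_abs]
  have key : ∀ (c a b : ℝ), |c| ≤ 1 → -(a ^ 2 + b ^ 2) / 2 ≤ a * (c * b) := by
    intro c a b hc
    have h1 : |a * (c * b)| ≤ (a ^ 2 + b ^ 2) / 2 := by
      rw [show a * (c * b) = c * (a * b) by ring, abs_mul, abs_mul]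
      have hab : |a| * |b| ≤ (a ^ 2 + b ^ 2) / 2 := by
        nlinarith [two_mul_le_add_sq (|a|) (|b|), sq_abs a, sq_abs b]
      calc |c| * (|a| * |b|) ≤ 1 * (|a| * |b|) :=
            mul_le_mul_of_nonneg_right hc (mul_nonneg (abs_nonneg _) (abs_nonneg _))
        _ ≤ (a ^ 2 + b ^ 2) / 2 := by rw [one_mul]; exact hab
    have h2 := neg_abs_le (a * (c * b))
    linarith
  have e0 := key c0 (u 0) (u 1) (hb _)
  have e1 := key c1 (u 1) (u 2) (hb _)
  have e2 := key c2 (u 2) (u 0) (hb _)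
  rw [hu]
  nlinarith [Real.pi_pos]

/-- Pointwise, `|f_GP(x)|²` is the sum of the squares of its three (orthogonal) modes. [folklore] -/
theorem gpForce_inner_self_apply (x : UnitAddTorus (Fin 3)) :
    ⟪gpForce x, gpForce x⟫_ℝ =
      ‖Torus.stokesMode (Pi.single (2 : Fin 3) (1 : ℤ)) (EuclideanSpace.single (0 : Fin 3) (1 : ℝ)) false x‖ ^ 2 +
        ‖Torus.stokesMode (Pi.single (0 : Fin 3) (1 : ℤ)) (EuclideanSpace.single (1 : Fin 3) (1 : ℝ)) false x‖ ^ 2 +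
        ‖Torus.stokesMode (Pi.single (1 : Fin 3) (1 : ℤ)) (EuclideanSpace.single (2 : Fin 3) (1 : ℝ)) false x‖ ^ 2 := by
  rw [real_inner_self_eq_norm_sq]
  simp [gpForce, Torus.stokesMode_apply, EuclideanSpace.norm_sq_eq, Fin.sum_univ_three, norm_smul,
    sq_abs]

/-- Squared norms of Stokes modes are integrable. [folklore] -/
theorem gpForce_integrable_norm_sq_stokesMode (k : Fin 3 → ℤ) (a : EuclideanSpace ℝ (Fin 3)) (c : Bool) :
    Integrable (fun x => ‖Torus.stokesMode k a c x‖ ^ 2) volume :=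
  ((Torus.stokesMode k a c).continuous.norm.pow 2).integrable_unitAddTorus

/-- **Energy of the Galloway–Proctor force**: `∫ |f_GP|² = 3/2` (three sine modes of amplitude
one, `∫ sin² = 1/2` each). [folklore] -/
theorem gpForce_integral_inner_self : ∫ x, ⟪gpForce x, gpForce x⟫_ℝ = 3 / 2 := by
  simp_rw [gpForce_inner_self_apply]
  have h12 : Integrable (fun x =>
      ‖Torus.stokesMode (Pi.single (2 : Fin 3) (1 : ℤ)) (EuclideanSpace.single (0 : Fin 3) (1 : ℝ)) false x‖ ^ 2 +
        ‖Torus.stokesMode (Pi.single (0 : Fin 3) (1 : ℤ)) (EuclideanSpace.single (1 : Fin 3) (1 : ℝ)) false x‖ ^ 2)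
      volume :=
    (gpForce_integrable_norm_sq_stokesMode _ _ _).add (gpForce_integrable_norm_sq_stokesMode _ _ _)
  rw [integral_add h12 (gpForce_integrable_norm_sq_stokesMode _ _ _),
    integral_add (gpForce_integrable_norm_sq_stokesMode _ _ _) (gpForce_integrable_norm_sq_stokesMode _ _ _),
    gpForce_integral_norm_sq_stokesMode (SteadyStatesLoudBounded.GpAdmissible.single_ne_zero 2),
    gpForce_integral_norm_sq_stokesMode (SteadyStatesLoudBounded.GpAdmissible.single_ne_zero 0),
    gpForce_integral_norm_sq_stokesMode (SteadyStatesLoudBounded.GpAdmissible.single_ne_zero 1),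
    PiLp.norm_single, PiLp.norm_single, PiLp.norm_single]
  norm_num

/-- Pointwise, `∑ᵢ ‖∂ᵢ f_GP(x)‖² = 4π² (cos² 2πx₀ + cos² 2πx₁ + cos² 2πx₂)`, written with the three
cosine Stokes modes. [folklore] -/
theorem gpForce_sum_norm_partialDeriv_sq (x : UnitAddTorus (Fin 3)) :
    ∑ i, ‖Torus.partialDeriv i gpForce x‖ ^ 2 =
      (2 * Real.pi) ^ 2 *
        (‖Torus.stokesMode (Pi.single (0 : Fin 3) (1 : ℤ)) (EuclideanSpace.single (1 : Fin 3) (1 : ℝ)) true x‖ ^ 2 +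
          ‖Torus.stokesMode (Pi.single (1 : Fin 3) (1 : ℤ)) (EuclideanSpace.single (2 : Fin 3) (1 : ℝ)) true x‖ ^ 2 +
          ‖Torus.stokesMode (Pi.single (2 : Fin 3) (1 : ℤ)) (EuclideanSpace.single (0 : Fin 3) (1 : ℝ)) true x‖ ^ 2) := by
  have h1 : Torus.IsContDiff 1 gpForce := gpForce_isSmooth.isContDiff (by simp)
  simp_rw [Torus.partialDeriv_eq_fderiv_apply h1, gpForce_fderiv_apply]
  rw [Fin.sum_univ_three]
  simp [norm_smul, mul_pow, sq_abs]
  ring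

/-- **Enstrophy of the Galloway–Proctor force**: `‖∇f_GP‖₂² = 6π²`. [folklore] -/
theorem gpForce_gradNormSq : Torus.gradNormSq gpForce = 6 * Real.pi ^ 2 := by
  unfold Torus.gradNormSq
  simp_rw [gpForce_sum_norm_partialDeriv_sq]
  have h01 : Integrable (fun x =>
      ‖Torus.stokesMode (Pi.single (0 : Fin 3) (1 : ℤ)) (EuclideanSpace.single (1 : Fin 3) (1 : ℝ)) true x‖ ^ 2 +
        ‖Torus.stokesMode (Pi.single (1 : Fin 3) (1 : ℤ)) (EuclideanSpace.single (2 : Fin 3) (1 : ℝ)) true x‖ ^ 2)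
      volume :=
    (gpForce_integrable_norm_sq_stokesMode _ _ _).add (gpForce_integrable_norm_sq_stokesMode _ _ _)
  rw [integral_const_mul, integral_add h01 (gpForce_integrable_norm_sq_stokesMode _ _ _),
    integral_add (gpForce_integrable_norm_sq_stokesMode _ _ _) (gpForce_integrable_norm_sq_stokesMode _ _ _),
    gpForce_integral_norm_sq_stokesMode (SteadyStatesLoudBounded.GpAdmissible.single_ne_zero 0),
    gpForce_integral_norm_sq_stokesMode (SteadyStatesLoudBounded.GpAdmissible.single_ne_zero 1),
    gpForce_integral_norm_sq_stokesMode (SteadyStatesLoudBounded.GpAdmissible.single_ne_zero 2),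
    PiLp.norm_single, PiLp.norm_single, PiLp.norm_single]
  norm_num
  ring

/-- `‖∇f_GP‖₂ = π√6`. [folklore] -/
theorem gpForce_sqrt_gradNormSq : Real.sqrt (Torus.gradNormSq gpForce) = Real.pi * Real.sqrt 6 := by
  rw [gpForce_gradNormSq, show (6 : ℝ) * Real.pi ^ 2 = Real.pi ^ 2 * 6 by ring,
    Real.sqrt_mul (sq_nonneg _), Real.sqrt_sq Real.pi_pos.le]

/-! ## The inertial pairing against `f_GP` on `L²` -/

/-- **The inertial pairing against `f_GP` is bounded below by the energy**:
`∫ ⟪Df_GP u, u⟫ ≥ -2π ‖u‖²_{L²}` for every `u ∈ L²(T³; ℝ³)`. [folklore] -/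
theorem gpForce_inertialPairing_ge (a : L2) :
    -(2 * Real.pi) * ‖a‖ ^ 2 ≤ Torus.inertialPairing a gpForce := by
  obtain ⟨C, _, hC⟩ := Torus.exists_sum_norm_partialDeriv_le gpForce_isSmooth
  have hI := (Torus.integrable_inner_fderiv_apply_coe gpForce_isSmooth hC a a).1
  have hn : Integrable (fun x => ‖(a : Vec3) x‖ ^ 2) volume :=
    (Lp.memLp a).integrable_norm_pow two_ne_zero
  rw [Torus.inertialPairing, ← Torus.integral_norm_sq_coe_eq, ← integral_const_mul]
  exact integral_mono (hn.const_mul _) hI fun x => gpForce_inner_fderiv_apply_ge x _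

/-- The inertial pairing against `f_GP` is quadratically bounded: `|∫ ⟪Df_GP u, u⟫| ≤ C ‖u‖²`. [folklore] -/
theorem gpForce_abs_inertialPairing_le :
    ∃ C : ℝ, 0 ≤ C ∧ ∀ a : L2, |Torus.inertialPairing a gpForce| ≤ C * ‖a‖ ^ 2 := by
  obtain ⟨C, hC0, hC⟩ := Torus.exists_sum_norm_partialDeriv_le gpForce_isSmooth
  refine ⟨C, hC0, fun a => ?_⟩
  have h := (Torus.integrable_inner_fderiv_apply_coe gpForce_isSmooth hC a a).2
  rw [Torus.inertialPairing, sq]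
  exact h

/-! ## The stub -/

/-- **S `stub_gpSmallEnergy`** — THE SECOND-MOMENT TEST WITH `w = f_GP`. For the Galloway–Proctor force
`f_GP` (`gpForce`): `‖f_GP‖₂² = 3/2`, `‖∇f_GP‖₂² = 6π²`, and `⟨∇f_GP(x) v, v⟩ ≥ −2π |v|²` pointwise, whence
`∫ ⟨f_GP − B(v,v), f_GP⟩ dμ = 3/2 + ∫∫⟨∇f_GP v, v⟩ ≥ 3/2 − 2π ∫|v|² dμ ≥ 3/2 − 2πE` for a probability
measure `μ` on `H` of mean energy `≤ E`; so a balance `|∫ ⟨f_GP − B(v,v), f_GP⟩ dμ| ≤ R ‖∇f_GP‖₂` forces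
`(3/2 − 2πE)/(π√6) ≤ R`. [folklore] -/
theorem stub_gpSmallEnergy (f : Vec3) (hf : f = gpForce) (E : ℝ) (μ : Measure H3)
    (hμ : IsProbabilityMeasure μ) (hint : Integrable (fun v : H3 => ‖v‖ ^ 2) μ)
    (hE : Torus.ensembleEnergy μ ≤ E) (R : ℝ)
    (hbal : |∫ v, Torus.nsGeneratorPairing 0 f v f ∂μ| ≤ R * Real.sqrt (Torus.gradNormSq f)) :
    (3 / 2 - 2 * Real.pi * E) / (Real.pi * Real.sqrt 6) ≤ R := by
  subst hf
  have hden : 0 < Real.pi * Real.sqrt 6 := by positivity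
  -- the tested generator, pointwise in `v`
  have hgen : ∀ v : H3, Torus.nsGeneratorPairing 0 gpForce v gpForce =
      3 / 2 + Torus.inertialPairing (v : L2) gpForce := by
    intro v
    rw [Torus.nsGeneratorPairing, gpForce_integral_inner_self, zero_mul, add_zero]
  -- integrability of `v ↦ ∫ (v ⊗ v) : ∇f_GP` (continuous, quadratically bounded)
  obtain ⟨C, _, hC⟩ := gpForce_abs_inertialPairing_le
  have hcont : Continuous fun v : H3 => Torus.inertialPairing (v : L2) gpForce :=
    Torus.continuous_inertialPairing_coe gpForce_isSmooth
  have hInt : Integrable (fun v : H3 => Torus.inertialPairing (v : L2) gpForce) μ := by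
    refine Integrable.mono' (hint.const_mul C) hcont.aestronglyMeasurable (ae_of_all _ fun v => ?_)
    rw [Real.norm_eq_abs, Submodule.coe_norm]
    exact hC (v : L2)
  -- integrate
  have hI1 : ∫ v, Torus.nsGeneratorPairing 0 gpForce v gpForce ∂μ =
      3 / 2 + ∫ v, Torus.inertialPairing (v : L2) gpForce ∂μ := by
    simp_rw [hgen]
    rw [integral_add (integrable_const _) hInt, integral_const]
    simp
  have hI2 : -(2 * Real.pi) * Torus.ensembleEnergy μ ≤ ∫ v, Torus.inertialPairing (v : L2) gpForce ∂μ := by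
    rw [Torus.ensembleEnergy, ← integral_const_mul]
    refine integral_mono (hint.const_mul _) hInt fun v => ?_
    rw [Submodule.coe_norm]
    exact gpForce_inertialPairing_ge (v : L2)
  have hE' : -(2 * Real.pi) * E ≤ -(2 * Real.pi) * Torus.ensembleEnergy μ :=
    mul_le_mul_of_nonpos_left hE (by linarith [Real.pi_pos])
  rw [gpForce_sqrt_gradNormSq] at hbal
  have habs := le_abs_self (∫ v, Torus.nsGeneratorPairing 0 gpForce v gpForce ∂μ)
  rw [div_le_iff₀ hden]
  linarith

end Summit.AnomalousDissipation.AnomalousDissipation.Theorems.EnsembleRigidity.GPStatisticalRigidity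

end
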